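import Mathlib
import HarnessLib
import HarnessLib.Audit
import Summits.QuantumFields.Statement
import Summits.QuantumFields.YangMills.Theses.BalabanLadder
import Literature.MathematicalPhysics.QuantumLattice.LatticeWilsonFlow
import Literature.MathematicalPhysics.QuantumFieldTheory.QCDTimeReflection
import Literature.MathematicalPhysics.QuantumLattice.TorusWilsonFlowContinuity
import Summits.QuantumFields.YangMills.Theorems.BalabanLadderNTConjugateResponse
import Summits.QuantumFields.YangMills.Theorems.LangevinControlUVOSLegsFromFemtoAndGapStubCollar
import HarnessLib.Audit.Status.Attr

/-!
Route: GradientFlowWitness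

DORMANT since 2026-09-02T10:30:05Z (reconciler: no traction for 5 d (last activity item-evidence-added at 2026-08-28T09:40:30Z); parked, not closed — `ledger route dormant route-QuantumFields-GradientFlowWitness --off` to reactivate) — unstaffed, not closed; items shared with open routes are served there. `ledger route dormant <id> --off` reactivates.

# Route GradientFlowWitness — NT clause (i) from an RP Cauchy–Schwarz witness whose one-point
function is the gradient-flow coupling (rev 1)

LINE (D-0145 ideator seat ym-idea-7, lens «transfer»; bears_on LADDER-YM rung R2a, leaf
`BalabanLadder.NT` = stmt-QuantumFields-19353; no summit is proved by this line). It suffices to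
show X = X1 ∧ X2 ∧ X4 ∧ X3: (X1, FlowedResponseFloor) along some unit a(β) → 0, at EVERY femto
radius ℓ > 0, the MIXED mirror covariance Cov_T(X̂_w∘cfgReflect, Ṽ_v) between a positive-time bare
smeared action density Ṽ_v = Σ_y v(a y) dens_y (v supported in {y₀ > 0} ∩ B(0, ℓ)) and the
femto-flowed energy probe X̂_w = ρ₀⁴ Σ_x w(a x) E_T(x̄)[Û] — Wilson flow time T = (ρ₀/a)² lattice
units, run on the mirror-doubled torus configuration Û = hat(U) (links of the fundamental domain
with base time in [0, L−1] kept, the whole antipodal slice |t| = L set to 1, the negative half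
filled with the OS site-reflection image), so X̂_w reads positive-time links EXACTLY — stays ≥ ε₁(ℓ)
> 0 in absolute value on every large torus; (X2, FlowedMirrorCeiling) the probe's own mirror form
E_T[(X̂_w∘cfgReflect)·X̂_w] − E_T[X̂_w]² stays ≤ C₂ along any unit carrying an X1 floor; (X4,
MirrorDefectVanishes = item stmt-QuantumFields-25440 of StaticSourceWitness, shared verbatim) along
a unit carrying a bare mirror floor the chirality defect |Q2(θv, v) − (E_T[(Ṽ_v∘cfgReflect)·Ṽ_v] −
E_T[Ṽ_v]²)| → 0 for v inside a femto radius ℓ₃; (X3, SkewnessResidual — the declared RESIDUAL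
conjunct) any (r, a) carrying clause (i) of LowerBounds upgrades to full LowerBounds G r a' for some
unit a'. The deciding theorem `closes : X1 → X2 → X4 → X3 → BalabanLadder.NT` is PROVED in the
kernel (rev 1): Osterwalder–Seiler reflection positivity of the odd torus Wilson measure in Gram
form (tree `NT.Reflection.sq_cov_negReflect_le_odd_pos`) gives Cov_T(X̂∘θ, Ṽ)² ≤ MF(X̂)·MF(Ṽ), hence
the bare mirror floor MF(Ṽ_v) ≥ ε₁²/max(C₂, 1) at every femto radius; this discharges X4's pin, and
X4 at radius ℓ₃ turns the bare floor into clause (i) with ε = ε₁(ℓ₃)²/(2 max(C₂,1)); X3 finishes.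
The transfer: the witness is the lattice-QCD GRADIENT-FLOW observable t²E_t (Luscher2010,
LuscherWeisz2011), whose one-point function IS a renormalised running coupling (t²⟨E_t⟩ = 3(N²−1)
ḡ²/(128π²) + O(ḡ⁴)) and whose correlators at positive flow time need no composite-operator
renormalisation — so the deciding floor X1 is the conjugate response of a UV-FINITE probe, a
relative-O(ḡ²) effect, instead of a relative-a⁴ effect on a bare plaquette.
Lean: `FlowedResponseFloor ∧ FlowedMirrorCeiling ∧ MirrorDefectVanishes ∧ SkewnessResidual`

## Assembly
PROVED (rev 1, `closes`, axioms propext/Classical.choice/Quot.sound only). From FlowedResponseFloor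
take (r, a); for any femto radius ℓ take its data (ρ₀, w, v, ε₁, β₅, Λ₅) (tsupport v ⊆ {y₀>0} ∩
B(0,ℓ)); FlowedMirrorCeiling on the same data gives C₂, β₆, Λ₆. For β ≥ max(β₅, β₆, β_a, 0) (β_a:
a(β) ≤ 1 eventually) and a(β)L ≥ max(Λ₅, Λ₆, ℓ+3): X̂_w is a continuous cylinder function of the
links based at times [0, L−1] (`continuous_flowedEnergy` + the doubled configuration `hat`,
valMinAbs bookkeeping), Ṽ_v one of the links based at times [1, L−2] (`continuous_dens`,
`isCylinder_dens`, `near_of_mem_supp_dens`, Schwartz support inside {y₀>0} ∩ B(0,ℓ));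
`MarkovMirror.dependsOn_posHalf_of_window` + `torusLift_negReflect` move both to the closed
non-negative half of the odd torus, where `Reflection.sq_cov_negReflect_le_odd_pos` (Gram form of
RP–CS) and `ConjugateResponse.cov_negReflect_self_nonneg` give Cov_T(X̂∘θ,Ṽ)² ≤ MF(X̂)·MF(Ṽ), MF(Ṽ)
≥ 0; with |Cov_T| ≥ ε₁ and MF(X̂) ≤ C₂ this is the bare floor MF(Ṽ_v) ≥ ε₁²/max(C₂,1). At ℓ = 1 the
bare floor discharges the pin of MirrorDefectVanishes, which returns ℓ₃; at ℓ = ℓ₃ the bare floor ε₀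
and the defect bound with η = ε₀/2 give Q2 G r β L (a β) (thetaTest 4 v) v ≥ ε₀/2 eventually —
clause (i) of LowerBounds for (r, a); SkewnessResidual returns a' with LowerBounds G r a', i.e.
BalabanLadder.NT.

CLOSES_TARGET: closes rung R2a of QuantumFields: Summit.QuantumFields.YangMills.Theses.BalabanLadder.NT (D-0061; not the summit Statement) — the deciding theorem of this route concludes that registered leaf instead of the Statement decl `YangMills` (class rung: servable and labelled, never counted as concluding the summit Statement).

Rationale: WHY THIS LINE. Mechanism: reflection positivity turns ANY positive-time observable X into a
lower-bound witness for the mirror form of the action density, MF(Ṽ_v) ≥ Cov_T(X∘θ, Ṽ_v)²/MF(X)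
(OsterwalderSeiler1978 §2; FrohlichIsraelLiebSimon1978 Thm 2.1; tree
`NT.Reflection.sq_cov_negReflect_le_odd_pos`, `QCDTimeReflection.cfgReflect`), and the
one-lattice-step chirality defect between MF(Ṽ_v) and Q2(θv, v) is a separate, shared item (X4 =
stmt-QuantumFields-25440). Imported from lattice QCD (area: non-perturbative renormalisation / scale
setting): the Yang–Mills gradient flow (Luscher2010 — t₀ scale, ⟨E_t⟩ finite; LuscherWeisz2011 —
flowed correlation functions are renormalised after renormalising the 4-d theory alone, to all
orders), typed in the tree as `LatticeWilsonFlow.flowedEnergy` (finite torus: the flow line exists,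
is unique and depends continuously on the configuration — `TorusWilsonFlowExistence`,
`TorusWilsonFlowContinuity.continuous_flowedEnergy`). What the line does that prior routes do not:
the lead line (ym-spine-19353-p1, CFPW/RefPkgT) and the FBL-type cards need Bałaban's effective
densities to RELATIVE precision a⁴ on every DLR exterior; cards rp-linearised-loop-response /
delta-sandwich / adiabatic-source use BARE or block-averaged one-point responses;
StaticSourceWitness (ym-idea-8) uses a Wilson-loop (line-operator, perimeter-law) dual vector;
ForcedResponseSkewness attacks clause (ii) from clause (i). Here the witness is a renormalised LOCAL
scalar probe with a printed, scheme-clean perturbative expansion, the ceiling X2 is sign-free, the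
glue is kernel-checked, and clause (ii) is imported as the declared residual. Negatives respected:
the line is false for U(1) (X1 ~ β⁻² → 0, no transmutation) — consistent with
`not_SelfNormalisedSkewness` (18944); nothing of CurvatureAnchor (15826) / RobustYangMillsRG (14958)
is restated.

RANKED CRUXES. #2 FlowedResponseFloor (crux, rev 1) — For every compact simple G there are a
faithful unitary lattice representation r and a unit a(β) > 0 with a → 0 such that for EVERY femto
radius ℓ > 0 there are a flow radius ρ₀ > 0, Schwartz weights w (probe) and v (action-density leg,
tsupport v ⊆ {y₀ > 0} ∩ B(0, ℓ)), ε₁ > 0, β₅, Λ₅ with |Cov_T(X̂_w∘cfgReflect, Ṽ_v)| ≥ ε₁ for all β ≥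
β₅ on all tori of side 2L+1 with a(β)L ≥ Λ₅; X̂_w(U) = Σ_x w(a x) ρ₀⁴ E_T(x̄)[hat U], T = (ρ₀/a)²,
hat U = the mirror-doubled torus configuration (links with base time in [0, L−1] kept, antipodal
slice |t| = L set to 1, negative half = OS site-reflection image), Ṽ_v(U) = Σ_y v(a y) dens_y(U).
[difficulty: open-problem] (why it might fail: needs ḡ²_GF(ρ₀; β) bounded below uniformly in β at
fixed physical ρ₀ ≤ ℓ (dimensional transmutation at every femto scale) AND uniformity in L — the ∀L
/ large-field wall every NT floor meets; the cold antipodal slice costs exp(−c(aL)²/ρ₀²) only.)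
[Luscher2010, LuscherWeisz2011, OsterwalderSeiler1978, arXiv:1006.4518, arXiv:1101.0963]
#3 FlowedMirrorCeiling (crux, rev 1) — For every compact simple G, every r, unit a (positive, → 0),
ρ₀ > 0, Schwartz w, v and ε₁ > 0: IF the X1-type floor |Cov_T(X̂_w∘cfgReflect, Ṽ_v)| ≥ ε₁ holds for
β ≥ β₅, a(β)L ≥ Λ₅ (this pins a to the physical scale), THEN E_T[(X̂_w∘cfgReflect)·X̂_w] −
E_T[X̂_w]² ≤ C₂ for all β ≥ β₆ and all L with a(β)L ≥ Λ₆. Sign-free hyperscaling ceiling for a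
flowed dimension-4 probe (second moment of t²E_t at physical flow time). [deps: FlowedResponseFloor]
[difficulty: XL] (why it might fail: uniformity in L (zero modes / large fields at arbitrarily large
aL) for the second moment of the flowed energy; a unit pinned only by the X1 floor might still let
T²E_T fluctuate at O(1) if ρ₀ ≫ √(8t₀).) [Luscher2010, LuscherWeisz2011, arXiv:1006.4518]
#4 SkewnessResidual (crux) — RESIDUAL (declared conjunct complement, not attacked by this line): for
every compact simple G, every r and unit a (positive, → 0), if clause (i) of LowerBounds holds for
(r, a) with some positive-time v, ε, β₅, Λ₅, then LowerBounds G r a' holds in full for some unit a'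
> 0 with a' → 0. Attacked elsewhere: route ForcedResponseSkewness, cards cumulant-polarisation /
skewness-from-asymptotic-freedom. [difficulty: open-problem] (why it might fail: a unit carrying a
two-point floor need not carry a three-point floor at the SAME or a boundedly rescaled unit if κ₃ is
log-suppressed relative to κ₂^(3/2); ∀L again.) [OsterwalderSeiler1978, Luscher2010,
route-QuantumFields-ForcedResponseSkewness]
#5 MirrorDefectVanishes (crux, SHARED verbatim with StaticSourceWitness item
stmt-QuantumFields-25440) — along every unit carrying a bare mirror floor there is a femto radius ℓ₃
such that for positive-time real Schwartz v supported in B(0, ℓ₃) the chirality defect |Q2(θv, v) −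
(E_T[(Ṽ_v∘cfgReflect)·Ṽ_v] − E_T[Ṽ_v]²)| is eventually ≤ η for every η > 0. [difficulty: L/XL] (why
it might fail: needs the scale-free two-point CEILING |Cov_T(dens_θx, dens_y)| ≲ a⁸/dist⁸
β-uniformly to the window edge (MomentBounds6 class, open).) [FrohlichIsraelLiebSimon1978,
Balaban1989LargeFieldII, MagnenRivasseauSeneor1993]

TWO-LAYER PLAN. FlowedResponseFloor ⇐ (F1) flowed Feynman–Hellman/response identity on the torus:
Cov_T(X̂∘θ, Ṽ_v) = ∂_σ E_T[X̂∘θ] under β ↦ β + σ v(a·) (finite-dimensional calculus; tree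
`ConjugateResponse.hasDerivAt_torusE_tilted_zero`) → (F2) tree-level lattice value of the response
with its sign and a⁰ scaling (lattice perturbation theory of the flowed energy, LuscherWeisz2011
§§4–5) → (F3) the non-perturbative remainder bound uniform in L (the wall). FlowedMirrorCeiling ⇐
(C1) second-moment hyperscaling of t²E_t at physical flow time on every torus (Bałaban small-field +
large-field suppression) → (C2) the antipodal cold slice is a heat-kernel-tail correction. Nothing
filed now.

KILL CRITERIA. Refuted outright (close refuted:FlowedResponseFloor) by: a compact simple G and
faithful r for which the mixed flowed–bare mirror covariance provably → 0 along EVERY unit a(β) at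
some femto radius (e.g. a rigorous proof that t²⟨E_t⟩ → 0 at fixed physical t along every a(β) —
triviality of the flow coupling); or a sign/identity showing Cov(E_T(x)[Û], dens_y) ≡ 0 for
mirror-separated x, y. Pivot (not death): if the cold antipodal slice of Û is shown to spoil X1/X2
by more than a constant, restate with the conditional-expectation witness E[X | positive links]
(same glue). Mooted if CFPW/RefPkgT (lead line) or StaticSourceWitness or ForcedResponseSkewness +
any clause-(i) carrier lands NT first.

NOT DECOMPOSED YET. F1–F3, C1–C2 are layer-2 children for tenure; constants (ρ₀ versus ℓ; ε₁ at tree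
level = 2ρ₀⁴∫∫ θw(x) v(y) [K_ρ₀ * C_F](x−y)² d⁴x d⁴y · ḡ⁴ up to group factors) are not fixed. The
flow on the finite torus is Lüscher's (tree `TorusWilsonFlowExistence`); no infinite-lattice flow is
used.

CHEAPEST FALSIFIER. (1) Free-field (Maxwell^dim G / lattice tree-level) computation of the CS
efficiency R₀ = Cov₀(θX̂,Ṽ_v)² / (MF₀(X̂) · MF₀(Ṽ_v)) for one concrete geometry (w, v bumps at
distance d across the plane, ρ₀ = d/10): tree level gives Cov₀(E_T(x), F²(y)) = 2[(K_T * C_F)(x−y)]²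
> 0 (no symmetry zero), so R₀ ∈ (0, 1]; R₀ = 0 by an overlooked selection rule kills X1 at birth.
(2) U(1) calibration: the same quantities scale like β⁻² → 0 — the line must and does fail for U(1)
(negatives 18944). (3) INSTRUMENT ROW that would refute X1: a lattice measurement of the mixed
flowed–unflowed correlator ⟨t²E_t(x) · s_W(y)⟩_c at fixed physical |x−y|, t across β = 6.0–6.9
(SU(3), standard Wilson-flow code) trending to 0 in the continuum limit rather than to a constant.
Not run here (kit 0 on this seat).

NUMBERS. t²⟨E_t⟩|_(t=t₀) = 0.3 defines t₀ (Luscher2010 §1); one loop t²⟨E⟩ =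
3(N²−1)ḡ²_MS(q=1/√(8t))/(128π²)(1 + c₁ḡ² + …) (Luscher2010 eq. (1.3), LuscherWeisz2011); smearing
radius √(8t); closes uses ε = ε₁(ℓ₃)²/(2·max(C₂,1)).

DEFINITION REQUESTS. None (hat, X̂_w, Ṽ_v are inlined `let`s over `flowedEnergy`, `cfgReflect`,
`dens`, `torusE`, `box`, `siteToE`). A tenure-time definition `mirrorDoubledConfig L : LGConfig 4 G
→ GaugeConfig 4 (2L+1) G` would shorten X1/X2.

Novelty: Searches (2026-08-28): lit search --hybrid "Wilson flow gradient flow energy density running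
coupling lattice" (8: Montvay–Münster p.425, Greensite, Creutz 2022 p.102, Bietenholz–Wiese 2025
p.525 — textbook flow/scale-setting, no RP use); lit search --hybrid "flowed energy density
correlator unflowed operator contact term small flow time expansion" (8, all off-topic fluids —
null); lit vsearch "lower bound on a truncated two-point function from reflection positivity and
Cauchy–Schwarz with an auxiliary observable" (8: Glimm–Jaffe pp.132/180, Rivasseau p.286 — RP/CS
generalities, no flowed witness); lit search --hybrid "reflection positivity Cauchy-Schwarz lower
bound two-point function lattice gauge" (8: Balaban–O'Carroll–Schor CMP 122 p.14, Montvay–Münster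
p.70, Friedli–Velenik p.499); lit search "Luscher Weisz perturbative analysis gradient flow" (6
corpus papers citing LW2011: arXiv:1409.1445, 1812.06692, 2603.29841, 1302.5246, 1703.04396,
1702.06289); lit galaxy search "Wilson flow" --star pdf (8: [galaxy:pdf:-2292944197462680740] Suzuki
thesis, [galaxy:pdf:2707976627234424220] master-field QCD …) and "gradient flow coupling" --star pdf
(6: [galaxy:pdf:1135934980] Del Debbio–Ramos 2101.04762 review, [galaxy:pdf:-1672948894073187720]
Lüscher 1302.5246); "gradient flow|Wilson flow|flowed energy density" --star all (30 rows, noise);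
tree: rg over Theses/*.lean, Cruxes/NT/Ideas (20 cards), Cruxes/NT/Lines, pub/ideators
ym-idea-3/5/6/8/10 STATUS, ledger negatives --problem Qua  [refs: 1409.1445, 1006.4518, 1101.0963, Luscher2010, LuscherWeisz2011]

Barriers (technique_class: reflection-positivity, gradient-flow, cauchy-schwarz-witness): - technique_class: reflection-positivity, gradient-flow, cauchy-schwarz-witness
- Literature.Barriers.QuantumFields.PerturbativeInvisibility: FlowedResponseFloor sits INSIDE its
class exactly as every NT floor does (a floor uniform in β at fixed physical scale = dimensional
transmutation); it does not evade it; the bet is that the quantity floored is the response of a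
UV-finite flowed probe whose perturbative series is scheme-clean (LuscherWeisz2011), so the
non-perturbative remainder to control is relative O(ḡ²) of a finite quantity, not relative a⁴ of a
bare one. FlowedMirrorCeiling is a CEILING (outside the class). SkewnessResidual is the declared
residual.
- Literature.Barriers.QuantumFields.ElitzurTheorem: outside — X̂_w is gauge-INVARIANT (flowed
plaquette traces of the gauge-covariantly doubled configuration Û: Û(U^g) = Û(U)^ĝ with ĝ the
mirror-doubled gauge function, crossing links 1 ↦ ĝĝ⁻¹ = 1), so no gauge-variant expectation is ever
floored (the fixed-profile score directions that Elitzur kills are not used).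
- Literature.Barriers.QuantumFields.FixedCouplingUltralocality: outside — every statement is along
a(β) → 0 with β → ∞ on tori aL ≥ Λ; no fixed-coupling continuum claim.
- Literature.Barriers.QuantumFields.AbelianDeconfinementD4: consistent — for U(1) the mixed
covariance is O(β⁻²) → 0 and X1 fails, as LowerBounds must (negatives 18944); cruxes quantify over
compact SIMPLE G.
- Literature.Barriers.QuantumFields.MigdalKadanoffGroupBlindness: outside — no approx

History (route lifecycle, newest last):
- 2026-08-28T04:03:17Z · rev 1: restated FlowedResponseFloor (stmt-QuantumFields-25276), FlowedMirrorCeiling (stmt-QuantumFields-25277), Assembly (stmt-QuantumFields-25279) — rev 1 (critic idea-crit-9 VERDICT #5 REQUIRED REPAIR): (a) X1/X2 re-typed — doubled configuration `hat` trivialises the whole antipodal slice |t| = L so the wit (planner-ym-idea-7-g0-0)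
- 2026-08-28T04:22:05Z · rev 1: restated FlowedResponseFloor (stmt-QuantumFields-25276), FlowedMirrorCeiling (stmt-QuantumFields-25277), Assembly (stmt-QuantumFields-25279) — rev 1 (critic idea-crit-9 VERDICT #5 REQUIRED REPAIR): (a) X1/X2 re-typed — doubled configuration `hat` trivialises the whole antipodal slice |t| = L so the wit (planner-ym-idea-7-g0-0)
- 2026-08-28T04:22:24Z · rev 1: restated FlowedResponseFloor (stmt-QuantumFields-25276), FlowedMirrorCeiling (stmt-QuantumFields-25277), Assembly (stmt-QuantumFields-25279) — rev 1 (critic idea-crit-9 VERDICT #5 REQUIRED REPAIR): (a) X1/X2 re-typed — doubled configuration `hat` trivialises the whole antipodal slice |t| = L so the wit (planner-ym-idea-7-g0-0)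
- 2026-08-28T04:30:27Z · rev 1: restated FlowedResponseFloor (stmt-QuantumFields-25276), FlowedMirrorCeiling (stmt-QuantumFields-25277), Assembly (stmt-QuantumFields-25279) — rev 1 (critic idea-crit-9 VERDICT #5 REQUIRED REPAIR): (a) X1/X2 re-typed — doubled configuration `hat` trivialises the whole antipodal slice |t| = L so the wit (planner-ym-idea-7-g0-0)
- 2026-09-02T10:30:05Z · DORMANT — reconciler: no traction for 5 d (last activity item-evidence-added at 2026-08-28T09:40:30Z); parked, not closed — `ledger route dormant route-QuantumFields-Grad (operator:999:256042)

sub-problem: YangMills · status: dormant · opened planner-ym-idea-7-g0-0 2026-08-28T03:18:41Z · rev 1 · ledger route-QuantumFields-GradientFlowWitness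
GENERATED by the gate from the ledger (D-0016/17). Provers cite these decls: `theorem foo : Summit.QuantumFields.YangMills.Theses.GradientFlowWitness.<Decl> := …` in Summits/QuantumFields/YangMills/Theorems/<Name>.lean.
-/

namespace Summit.QuantumFields.YangMills.Theses.GradientFlowWitness

open scoped BigOperators Topology Manifold Classical MeasureTheory ProbabilityTheory Matrix InnerProductSpace ComplexConjugate ContinuousMap
open Filter Set Function TopologicalSpace MeasureTheory

attribute [summit_statement] _root_.YangMills
attribute [summit_statement] _root_.Summit.QuantumFields.YangMills.Theses.BalabanLadder.NT

-- earlier FlowedResponseFloor (stmt-QuantumFields-25276, replaced 2026-08-28T04:30:27Z -> stmt-QuantumFields-25684): retired by None — open Literature.MathematicalPhysics.QuantumFieldTheory Literature.MathematicalPhysics.QuantumLattice Literature.MathematicalPhysics.AQFT Literature.Probability.LatticeModels Summit.QuantumFields.YangMills.Cruxes.OSLegsFromFemtoAndGap.DlrCollarTransfer in ∀ (G : Type)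
/-- item stmt-QuantumFields-25684 · crux · rank 2 · open · by planner
why it might fail: needs ḡ²_GF(ρ₀; β) bounded below uniformly in β at fixed physical ρ₀ ≤ ℓ for every femto ℓ (dimensional transmutation) AND uniformity in L — the ∀L / large-field wall every NT floor meets; the cold antipodal slice costs a heat-kernel tail only.
sources: Luscher2010, LuscherWeisz2011, OsterwalderSeiler1978, arXiv:1006.4518, arXiv:1101.0963
[crux] (rev 1) For every compact simple G there are a faithful unitary lattice representation r and
a unit a(β) > 0 with a → 0 such that for EVERY femto radius ℓ > 0 there are a flow radius ρ₀ > 0,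
Schwartz weights w (probe) and v (action-density leg, tsupport v ⊆ {y₀ > 0} ∩ B(0, ℓ)), ε₁ > 0, β₅,
Λ₅ with |Cov_T(X̂_w∘cfgReflect, Ṽ_v)| ≥ ε₁ for all β ≥ β₅ on all tori of side 2L+1 with a(β)L ≥ Λ₅,
where X̂_w(U) = Σ_x w(a x) ρ₀⁴ E_T(x̄)[hat U] (Wilson flow time T = (ρ₀/a)² lattice units on the
mirror-doubled torus configuration hat U: links with base time in [0, L−1] kept, antipodal slice |t|
= L set to 1, negative half = OS site-reflection image — so X̂_w reads positive-time links only),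
Ṽ_v(U) = Σ_y v(a y) dens_y(U), Cov_T(A∘θ, B) = torusE(A∘cfgReflect · B) − torusE A · torusE B.
[difficulty: open-problem] -/
@[route_item "route-QuantumFields-GradientFlowWitness", crux]
def FlowedResponseFloor : Prop :=
  open Literature.MathematicalPhysics.QuantumFieldTheory Literature.MathematicalPhysics.QuantumLattice Literature.MathematicalPhysics.AQFT Literature.Probability.LatticeModels Summit.QuantumFields.YangMills.Cruxes.OSLegsFromFemtoAndGap.DlrCollarTransfer in ∀ (G : Type) [Group G] [TopologicalSpace G] [IsTopologicalGroup G] [CompactSpace G], IsCompactSimpleLieGroup G → letI : MeasurableSpace G := borel G; haveI : BorelSpace G := ⟨rfl⟩; ∃ (r : LatticeRep G) (a : ℝ → ℝ), (∀ β, 0 < a β) ∧ Tendsto a atTop (nhds 0) ∧ ∀ ℓ : ℝ, 0 < ℓ → ∃ (ρ₀ : ℝ) (w v : SchwartzMap (EuclideanSpace ℝ (Fin 4)) ℝ) (ε₁ β₅ Λ₅ : ℝ), 0 < ρ₀ ∧ tsupport (v : EuclideanSpace ℝ (Fin 4) → ℝ) ⊆ {y | 0 < y 0} ∧ tsupport (v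 : EuclideanSpace ℝ (Fin 4) → ℝ) ⊆ Metric.closedBall 0 ℓ ∧ 0 < ε₁ ∧ ∀ β : ℝ, β₅ ≤ β → ∀ L : ℕ, Λ₅ ≤ a β * L → let hat : LGConfig 4 G → ((Fin 4 → ZMod (2 * L + 1)) × Fin 4 → G) := (fun U e => if ((e.1 0).valMinAbs).natAbs = L then (1 : G) else if 0 ≤ (e.1 0).valMinAbs then U (fun i => (e.1 i).valMinAbs, e.2) else if e.2 = 0 then (U (Function.update (fun i => (e.1 i).valMinAbs) 0 (-(e.1 0).valMinAbs - 1), 0))⁻¹ else U (Function.update (fun i => (e.1 i).valMinAbs) 0 (-(e.1 0).valMinAbs), e.2)); let X : LGConfig 4 G → ℝ := (fun U => ∑ x ∈ box 4 L, w (a β • siteToE x) * (ρ₀ ^ 4 * flowedEnergy r.ρ ((ρ₀ / a β) ^ 2) (fun i => ((x i : ℤ) : ZMod (2 * L + 1))) (hat U))); let V : LGConfig 4 G → ℝ := (fun U => ∑ y ∈ box 4 L, v (a β • siteToE y) * dens G r y U); ε₁ ≤ |torusE G r β L (fun U => X (cfgReflect U) * V U) - torusE G r β L X * torusE G r β L 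V|

-- earlier FlowedMirrorCeiling (stmt-QuantumFields-25277, replaced 2026-08-28T04:30:27Z -> stmt-QuantumFields-25685): retired by None — open Literature.MathematicalPhysics.QuantumFieldTheory Literature.MathematicalPhysics.QuantumLattice Literature.MathematicalPhysics.AQFT Literature.Probability.LatticeModels Summit.QuantumFields.YangMills.Cruxes.OSLegsFromFemtoAndGap.DlrCollarTransfer in ∀ (G : Type)
/-- item stmt-QuantumFields-25685 · crux · rank 3 · open · by planner
why it might fail: uniformity in L (torus zero modes / large fields at arbitrarily large aL) for the second moment of the flowed energy; a unit pinned only by the X1 floor might still let T²E_T fluctuate at O(1) if ρ₀ ≫ √(8t₀) (confining flow times).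
sources: Luscher2010, LuscherWeisz2011, arXiv:1006.4518
[crux] (rev 1) For every compact simple G, every r, every unit a (positive, → 0), every ρ₀ > 0,
Schwartz w, v and ε₁ > 0: IF the X1-type floor |Cov_T(X̂_w∘cfgReflect, Ṽ_v)| ≥ ε₁ holds for β ≥ β₅,
a(β)L ≥ Λ₅ (this pins a to the physical scale), THEN the probe's mirror form is bounded:
torusE((X̂_w∘cfgReflect)·X̂_w) − (torusE X̂_w)² ≤ C₂ for all β ≥ β₆ and all L with a(β)L ≥ Λ₆ (same
hat, X̂_w as in FlowedResponseFloor). Sign-free hyperscaling ceiling for a flowed dimension-4 probe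
(second moment of t²E_t at physical flow time), no relative precision needed. [deps:
FlowedResponseFloor] [difficulty: XL] -/
@[route_item "route-QuantumFields-GradientFlowWitness", crux]
def FlowedMirrorCeiling : Prop :=
  open Literature.MathematicalPhysics.QuantumFieldTheory Literature.MathematicalPhysics.QuantumLattice Literature.MathematicalPhysics.AQFT Literature.Probability.LatticeModels Summit.QuantumFields.YangMills.Cruxes.OSLegsFromFemtoAndGap.DlrCollarTransfer in ∀ (G : Type) [Group G] [TopologicalSpace G] [IsTopologicalGroup G] [CompactSpace G], IsCompactSimpleLieGroup G → letI : MeasurableSpace G := borel G; haveI : BorelSpace G := ⟨rfl⟩; ∀ (r : LatticeRep G) (a : ℝ → ℝ) (ρ₀ : ℝ) (w v : SchwartzMap (EuclideanSpace ℝ (Fin 4)) ℝ) (ε₁ β₅ Λ₅ : ℝ), (∀ β, 0 < a β) → Tendsto a atTop (nhds 0) → 0 < ρ₀ → 0 < ε₁ → (∀ β : ℝ, β₅ ≤ β → ∀ L : ℕ, Λ₅ ≤ a β * L → let hat : LGConfig 4 G → ((Fin 4 → ZMod (2 * L + 1)) × Fin 4 → G) := (fun U e => if ((e.1 0).valMinAbs).natAbs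 = L then (1 : G) else if 0 ≤ (e.1 0).valMinAbs then U (fun i => (e.1 i).valMinAbs, e.2) else if e.2 = 0 then (U (Function.update (fun i => (e.1 i).valMinAbs) 0 (-(e.1 0).valMinAbs - 1), 0))⁻¹ else U (Function.update (fun i => (e.1 i).valMinAbs) 0 (-(e.1 0).valMinAbs), e.2)); let X : LGConfig 4 G → ℝ := (fun U => ∑ x ∈ box 4 L, w (a β • siteToE x) * (ρ₀ ^ 4 * flowedEnergy r.ρ ((ρ₀ / a β) ^ 2) (fun i => ((x i : ℤ) : ZMod (2 * L + 1))) (hat U))); let V : LGConfig 4 G → ℝ := (fun U => ∑ y ∈ box 4 L, v (a β • siteToE y) * dens G r y U); ε₁ ≤ |torusE G r β L (fun U => X (cfgReflect U) * V U) - torusE G r β L X * torusE G r β L V|) → ∃ (C₂ β₆ Λ₆ : ℝ), ∀ β : ℝ, β₆ ≤ β → ∀ L : ℕ, Λ₆ ≤ a β * L → let hat : LGConfig 4 G → ((Fin 4 → ZMod (2 * L + 1)) × Fin 4 → G) := (fun U e => if ((e.1 0).valMinAbs).natAbs = L then (1 : G) else if 0 ≤ (e.1 0).valMinAbs then U (fun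 i => (e.1 i).valMinAbs, e.2) else if e.2 = 0 then (U (Function.update (fun i => (e.1 i).valMinAbs) 0 (-(e.1 0).valMinAbs - 1), 0))⁻¹ else U (Function.update (fun i => (e.1 i).valMinAbs) 0 (-(e.1 0).valMinAbs), e.2)); let X : LGConfig 4 G → ℝ := (fun U => ∑ x ∈ box 4 L, w (a β • siteToE x) * (ρ₀ ^ 4 * flowedEnergy r.ρ ((ρ₀ / a β) ^ 2) (fun i => ((x i : ℤ) : ZMod (2 * L + 1))) (hat U))); torusE G r β L (fun U => X (cfgReflect U) * X U) - torusE G r β L X ^ 2 ≤ C₂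

/-- item stmt-QuantumFields-25278 · crux · rank 4 · open · by planner
why it might fail: a unit carrying a two-point floor need not carry a three-point floor at the SAME or a boundedly rescaled unit if κ₃ of the bare density is log-suppressed relative to κ₂^(3/2) (perturbative skewness ∝ ḡ); ∀L again.
sources: OsterwalderSeiler1978, Luscher2010, route-QuantumFields-ForcedResponseSkewness
[crux] RESIDUAL (declared conjunct complement, not attacked by this line): for every compact simple
G, every r and unit a (positive, → 0), if clause (i) of LowerBounds holds for (r, a) with some
positive-time v, ε, β₅, Λ₅, then LowerBounds G r a' holds in full (clauses (i) and (ii)) for some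
unit a' > 0 with a' → 0. Attacked elsewhere: route ForcedResponseSkewness (action sum rule + MVT),
cards cumulant-polarisation / skewness-from-asymptotic-freedom. [difficulty: open-problem] -/
@[route_item "route-QuantumFields-GradientFlowWitness", crux]
def SkewnessResidual : Prop :=
  open Literature.MathematicalPhysics.QuantumFieldTheory Literature.MathematicalPhysics.QuantumLattice Literature.MathematicalPhysics.AQFT Literature.Probability.LatticeModels Summit.QuantumFields.YangMills.Cruxes.OSLegsFromFemtoAndGap.DlrCollarTransfer in ∀ (G : Type) [Group G] [TopologicalSpace G] [IsTopologicalGroup G] [CompactSpace G], IsCompactSimpleLieGroup G → letI : MeasurableSpace G := borel G; haveI : BorelSpace G := ⟨rfl⟩; ∀ (r : LatticeRep G) (a : ℝ → ℝ), (∀ β, 0 < a β) → Tendsto a atTop (nhds 0) → (∃ (v : SchwartzMap (EuclideanSpace ℝ (Fin 4)) ℝ) (ε β₅ Λ₅ : ℝ), tsupport v ⊆ {y : EuclideanSpace ℝ (Fin 4) | 0 < y 0} ∧ 0 < ε ∧ ∀ β : ℝ, β₅ ≤ β → ∀ L : ℕ, Λ₅ ≤ a β * L → ε ≤ Q2 G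 r β L (a β) (thetaTest 4 v) v) → ∃ a' : ℝ → ℝ, (∀ β, 0 < a' β) ∧ Tendsto a' atTop (nhds 0) ∧ LowerBounds G r a'

/-- item stmt-QuantumFields-25440 · crux · rank 5 · open · by planner
why it might fail: needs the hyperscaling ceiling |Cov_T(dens_θx, dens_y)| ≤ C a⁸/dist⁸ β-uniformly to the window edge at the physical unit (MomentBounds6/FBL6 class, open: landed AfOnset-type bounds carry s⁻⁸); the pin excludes non-physical units only.
sources: FrohlichIsraelLiebSimon1978, Balaban1989LargeFieldII, MagnenRivasseauSeneor1993
[crux] (rev 1, VERDICT #6 price 1; ROUTE-NEUTRAL pin so the item can be shared with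
GradientFlowWitness per the director note) For every compact simple G, every r and every unit a
(positive, → 0) THAT CARRIES A BARE MIRROR FLOOR (some positive-time real Schwartz v₀ and ε₀ > 0
with ε₀ ≤ E_T[(Ṽ₀∘cfgReflect)·Ṽ₀] − E_T[Ṽ₀]² for all large β on all large tori — any RP-witness line
produces this before it needs the defect; it pins a to the physical scale) there is a femto radius
ℓ₃ > 0 such that for every real Schwartz v with tsupport v ⊆ {y₀ > 0} ∩ B(0, ℓ₃) and every η > 0,
eventually in β and on all tori aβ·L ≥ Λ₇: |Q2_(β,L,aβ)(θv, v) − (E_T[(Ṽ∘cfgReflect)·Ṽ] − E_T[Ṽ]²)|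
≤ η. The defect is the link reflection s one-step shift of timelike plaquettes: Σ [v(aβ(x−e₀)) −
v(aβx)]·v(aβy)·Cov_T(T_(θx), dens_y) — one power of aβ times a smeared two-point sum at mirror
separation; it vanishes under a scale-free two-point CEILING in the window (MomentBounds6 class).
Assembly use: K1(ℓ₂)+K2 give the bare floor (discharging the pin), then K1 is re-invoked at min(ℓ₂,
ℓ₃). -/
@[route_item "route-QuantumFields-GradientFlowWitness", crux]
def MirrorDefectVanishes : Prop :=
  open Literature.MathematicalPhysics.QuantumFieldTheory Literature.MathematicalPhysics.QuantumLattice Literature.Probability.LatticeModels Summit.QuantumFields.YangMills.Cruxes.OSLegsFromFemtoAndGap.DlrCollarTransfer in ∀ (G : Type) [Group G] [TopologicalSpace G] [IsTopologicalGroup G] [CompactSpace G], IsCompactSimpleLieGroup G → letI : MeasurableSpace G := borel G; haveI : BorelSpace G := ⟨rfl⟩; ∀ (r : LatticeRep G) (a : ℝ → ℝ), (∀ β, 0 < a β) → Filter.Tendsto a Filter.atTop (nhds 0) → (∃ (v₀ : SchwartzMap (EuclideanSpace ℝ (Fin 4)) ℝ) (ε₀ β₀ Λ₀ : ℝ), tsupport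 (v₀ : EuclideanSpace ℝ (Fin 4) → ℝ) ⊆ {y | 0 < y 0} ∧ 0 < ε₀ ∧ ∀ β : ℝ, β₀ ≤ β → ∀ L : ℕ, Λ₀ ≤ a β * L → ε₀ ≤ torusE G r β L (fun V => (∑ y ∈ box 4 L, v₀ (a β • siteToE y) * dens G r y (cfgReflect V)) * ∑ y ∈ box 4 L, v₀ (a β • siteToE y) * dens G r y V) - torusE G r β L (fun V => ∑ y ∈ box 4 L, v₀ (a β • siteToE y) * dens G r y V) ^ 2) → ∃ ℓ₃ : ℝ, 0 < ℓ₃ ∧ ∀ (v : SchwartzMap (EuclideanSpace ℝ (Fin 4)) ℝ), tsupport (v : EuclideanSpace ℝ (Fin 4) → ℝ) ⊆ {y | 0 < y 0} → tsupport (v : EuclideanSpace ℝ (Fin 4) → ℝ) ⊆ Metric.closedBall 0 ℓ₃ → ∀ η : ℝ, 0 < η → ∃ (β₇ Λ₇ : ℝ), ∀ β : ℝ, β₇ ≤ β → ∀ L : ℕ, Λ₇ ≤ a β * L → |Q2 G r β L (a β) (thetaTest 4 v) v - (torusE G r β L (fun V => (∑ y ∈ box 4 L, v (a β • siteToE y)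 * dens G r y (cfgReflect V)) * ∑ y ∈ box 4 L, v (a β • siteToE y) * dens G r y V) - torusE G r β L (fun V => ∑ y ∈ box 4 L, v (a β • siteToE y) * dens G r y V) ^ 2)| ≤ η

-- earlier Assembly (stmt-QuantumFields-25279, replaced 2026-08-28T04:30:27Z -> stmt-QuantumFields-25686): retired by None — FlowedResponseFloor → FlowedMirrorCeiling → SkewnessResidual → Summit.QuantumFields.YangMills.Theses.BalabanLadder.NT
/-- item stmt-QuantumFields-25686 · assembly · rank 1 · closed · proved by Summit.QuantumFields.YangMills.Theses.GradientFlowWitness.assembly_proof (prover) · by planner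
sources: OsterwalderSeiler1978, FrohlichIsraelLiebSimon1978, Luscher2010
[assembly] (rev 1) FlowedResponseFloor → FlowedMirrorCeiling → MirrorDefectVanishes →
SkewnessResidual → BalabanLadder.NT. The deciding theorem `closes` in glue.lean IS this implication
and is PROVED in the kernel at rev 1 (Gram-form RP–CS `NT.Reflection.sq_cov_negReflect_le_odd_pos` +
`ConjugateResponse.cov_negReflect_self_nonneg`, cylinder/continuity plumbing of the doubled flowed
probe through `torusLift`, the shared defect item at femto radius ℓ₃, the residual for clause (ii));
this item is closed by `fun h₁ h₂ h₄ h₃ => closes h₁ h₂ h₄ h₃`. -/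
@[route_item "route-QuantumFields-GradientFlowWitness"]
def Assembly : Prop :=
  Summit.QuantumFields.YangMills.Theses.GradientFlowWitness.FlowedResponseFloor → Summit.QuantumFields.YangMills.Theses.GradientFlowWitness.FlowedMirrorCeiling → Summit.QuantumFields.YangMills.Theses.GradientFlowWitness.MirrorDefectVanishes → Summit.QuantumFields.YangMills.Theses.GradientFlowWitness.SkewnessResidual → Summit.QuantumFields.YangMills.Theses.BalabanLadder.NT

-- `Assembly` holds: proved by `Summit.QuantumFields.YangMills.Theses.GradientFlowWitness.assembly_proof` (its module imports this route file, so no `_holds` link can be stated here).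

/-! D-0027 §2.1 — DECIDING THEOREM (planner-authored via `route open/edit --closes-file`; by planner-ym-idea-7-g0-0 2026-08-28T04:30:27Z):
its hypotheses are this route's items and its conclusion the registered leaf `Summit.QuantumFields.YangMills.Theses.BalabanLadder.NT` (rung R2a, D-0061) (glue_lint), and it elaborates with this file. -/

@[closes "route-QuantumFields-GradientFlowWitness"] theorem closes (h₁ : FlowedResponseFloor) (h₂ : FlowedMirrorCeiling) (h₄ : MirrorDefectVanishes)
    (h₃ : SkewnessResidual) : Summit.QuantumFields.YangMills.Theses.BalabanLadder.NT := by
  intro G _ _ _ _ hG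
  letI : MeasurableSpace G := borel G
  haveI : BorelSpace G := ⟨rfl⟩
  obtain ⟨r, a, ha, ha0, hfl⟩ := h₁ G hG
  haveI := r.secondCountableTopology
  let E := Cruxes.OSLegsFromFemtoAndGap.DlrCollarTransfer.torusE G r
  let θ : Literature.MathematicalPhysics.QuantumLattice.LGConfig 4 G → Literature.MathematicalPhysics.QuantumLattice.LGConfig 4 G := Literature.MathematicalPhysics.QuantumFieldTheory.cfgReflect
  let Vs : SchwartzMap (EuclideanSpace ℝ (Fin 4)) ℝ → ℝ → ℕ → Literature.MathematicalPhysics.QuantumLattice.LGConfig 4 G → ℝ := fun v β L U =>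
    ∑ y ∈ Literature.Probability.LatticeModels.box 4 L, v (a β • Literature.MathematicalPhysics.QuantumLattice.siteToE y) * Cruxes.OSLegsFromFemtoAndGap.DlrCollarTransfer.dens G r y U
  let MF : SchwartzMap (EuclideanSpace ℝ (Fin 4)) ℝ → ℝ → ℕ → ℝ := fun v β L =>
    E β L (fun V => Vs v β L (θ V) * Vs v β L V) - E β L (Vs v β L) ^ 2
  obtain ⟨βa, hβa⟩ : ∃ βa : ℝ, ∀ β, βa ≤ β → a β ≤ 1 :=
    Filter.eventually_atTop.mp (ha0.eventually (eventually_le_nhds one_pos))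
  have hval : ∀ (L : ℕ) (z : ZMod (2 * L + 1)), -(L : ℤ) ≤ z.valMinAbs ∧ z.valMinAbs ≤ L := fun L z => by
    have := ZMod.natAbs_valMinAbs_le z; omega
  -- STEP A: bare mirror floor at every femto radius (RP Cauchy–Schwarz in Gram form + ceiling).
  have bare : ∀ ℓ : ℝ, 0 < ℓ → ∃ (v : SchwartzMap (EuclideanSpace ℝ (Fin 4)) ℝ) (ε₀ β₀ Λ₀ : ℝ),
      tsupport (v : EuclideanSpace ℝ (Fin 4) → ℝ) ⊆ {y | 0 < y 0} ∧
      tsupport (v : EuclideanSpace ℝ (Fin 4) → ℝ) ⊆ Metric.closedBall 0 ℓ ∧ 0 < ε₀ ∧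
      ∀ β : ℝ, β₀ ≤ β → ∀ L : ℕ, Λ₀ ≤ a β * L → ε₀ ≤ MF v β L := by
    intro ℓ hℓ
    obtain ⟨ρ₀, w, v, ε₁, β₅, Λ₅, hρ₀, hvp, hvb, hε₁, hF⟩ := hfl ℓ hℓ
    obtain ⟨C₂, β₆, Λ₆, hC⟩ := h₂ G hG r a ρ₀ w v ε₁ β₅ Λ₅ ha ha0 hρ₀ hε₁ hF
    refine ⟨v, ε₁ ^ 2 / max C₂ 1, max (max β₅ β₆) (max βa 0), max (max Λ₅ Λ₆) (ℓ + 3), hvp, hvb,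
      by positivity, ?_⟩
    intro β hβ L hL
    simp only [max_le_iff] at hβ hL
    have ha1 : a β ≤ 1 := hβa β hβ.2.1
    have haβ : 0 < a β := ha β
    have hL1 : 1 ≤ L := by
      rcases Nat.eq_zero_or_pos L with h | h
      · subst h; simp only [Nat.cast_zero, mul_zero] at hL; linarith
      · exact h
    let H : Literature.MathematicalPhysics.QuantumLattice.LGConfig 4 G → Literature.MathematicalPhysics.QuantumFieldTheory.GaugeConfig 4 (2 * L + 1) G := fun U e =>
      if ((e.1 0).valMinAbs).natAbs = L then (1 : G) else if 0 ≤ (e.1 0).valMinAbs then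
      U (fun i => (e.1 i).valMinAbs, e.2) else if e.2 = 0 then
      (U (Function.update (fun i => (e.1 i).valMinAbs) 0 (-(e.1 0).valMinAbs - 1), 0))⁻¹ else
      U (Function.update (fun i => (e.1 i).valMinAbs) 0 (-(e.1 0).valMinAbs), e.2)
    let Xf : Literature.MathematicalPhysics.QuantumLattice.LGConfig 4 G → ℝ := fun U => ∑ x ∈ Literature.Probability.LatticeModels.box 4 L, w (a β • Literature.MathematicalPhysics.QuantumLattice.siteToE x) *
      (ρ₀ ^ 4 * Literature.MathematicalPhysics.QuantumLattice.flowedEnergy r.ρ ((ρ₀ / a β) ^ 2) (fun i => ((x i : ℤ) : ZMod (2 * L + 1))) (H U))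
    have hF' : ε₁ ≤ |E β L (fun U => Xf (θ U) * Vs v β L U) - E β L Xf * E β L (Vs v β L)| :=
      hF β hβ.1.1 L hL.1.1
    have hC' : E β L (fun U => Xf (θ U) * Xf U) - E β L Xf ^ 2 ≤ C₂ := hC β hβ.1.2 L hL.1.2
    have hXc : Continuous Xf := by
      refine continuous_finsetSum _ fun x _ => continuous_const.mul (continuous_const.mul ?_)
      refine (Literature.MathematicalPhysics.QuantumLattice.continuous_flowedEnergy r.ρ r.continuous r.mem_unitary _ _).comp ?_
      refine continuous_pi fun e => ?_
      dsimp only [H]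
      by_cases h1 : ((e.1 0).valMinAbs).natAbs = L
      · simp only [h1, ↓reduceIte]; exact continuous_const
      · simp only [h1, ↓reduceIte]
        by_cases h2 : 0 ≤ (e.1 0).valMinAbs
        · simp only [h2, ↓reduceIte]; exact continuous_apply _
        · simp only [h2, ↓reduceIte]
          by_cases h3 : e.2 = 0
          · simp only [h3, ↓reduceIte]; exact (continuous_apply _).inv
          · simp only [h3, ↓reduceIte]; exact continuous_apply _
    let SX : Finset (Literature.MathematicalPhysics.QuantumLattice.ZdEdge 4) :=
      ((Literature.Probability.LatticeModels.box 4 L).filter fun x => 0 ≤ x 0 ∧ x 0 + 1 ≤ (L : ℤ)) ×ˢ (Finset.univ : Finset (Fin 4))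
    have hSX : ∀ e ∈ SX, 0 ≤ e.1 0 ∧ e.1 0 + 1 ≤ (L : ℤ) := fun e he => by
      simp only [SX, Finset.mem_product, Finset.mem_filter] at he; exact he.1.2
    have hbx : ∀ e : Literature.MathematicalPhysics.QuantumFieldTheory.Edge 4 (2 * L + 1), ∀ c : ℤ, 0 ≤ c → c + 1 ≤ (L : ℤ) → ∀ j : Fin 4,
        (Function.update (fun i => (e.1 i).valMinAbs) 0 c, j) ∈ (SX : Set (Literature.MathematicalPhysics.QuantumLattice.ZdEdge 4)) := by
      intro e c hc0 hc1 j
      refine Finset.mem_coe.2 (Finset.mem_product.2 ⟨Finset.mem_filter.2 ⟨Literature.Probability.LatticeModels.mem_box.2 fun i => ?_, ?_⟩,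
        Finset.mem_univ _⟩)
      · by_cases hi : i = 0
        · subst hi; simp only [Function.update_self]; omega
        · simp only [Function.update_of_ne hi]; exact hval L (e.1 i)
      · simp only [Function.update_self]; omega
    have hXS : Literature.MathematicalPhysics.QuantumLattice.IsCylinder Xf SX := by
      intro U W hUW
      refine Finset.sum_congr rfl fun x _ => ?_
      have hH : H U = H W := by
        funext e
        have h0 := hval L (e.1 0)
        dsimp only [H]
        split_ifs with h1 h2 h3
        · rfl
        · have := hbx e _ h2 (by omega) e.2
          simp only [Function.update_eq_self] at this
          exact hUW _ this
        · rw [hUW _ (hbx e _ (by omega) (by omega) 0)]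
        · exact hUW _ (hbx e _ (by omega) (by omega) e.2)
      simp only [hH]
    have hVc : Continuous (Vs v β L) :=
      continuous_finsetSum _ fun y _ => continuous_const.mul (Cruxes.OSLegsFromFemtoAndGap.DlrCollarTransfer.continuous_dens r y)
    have hwin : ∀ y : Fin 4 → ℤ, v (a β • Literature.MathematicalPhysics.QuantumLattice.siteToE y) ≠ 0 → 1 ≤ y 0 ∧ y 0 + 3 ≤ (L : ℤ) := by
      intro y hy
      have hm : a β • Literature.MathematicalPhysics.QuantumLattice.siteToE y ∈ tsupport (v : EuclideanSpace ℝ (Fin 4) → ℝ) :=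
        subset_tsupport _ (Function.mem_support.2 hy)
      have h0 : (a β • Literature.MathematicalPhysics.QuantumLattice.siteToE y) 0 = a β * (y 0 : ℝ) := by simp [Literature.MathematicalPhysics.QuantumLattice.siteToE_apply]
      have hp : 0 < a β * (y 0 : ℝ) := by simpa only [Set.mem_setOf_eq, h0] using hvp hm
      have hy0 : 0 < (y 0 : ℝ) := (mul_pos_iff_of_pos_left haβ).mp hp
      have h2 : ‖(a β • Literature.MathematicalPhysics.QuantumLattice.siteToE y) 0‖ ≤ ‖a β • Literature.MathematicalPhysics.QuantumLattice.siteToE y‖ := PiLp.norm_apply_le _ _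
      rw [h0, Real.norm_eq_abs, abs_of_pos hp] at h2
      have h1 : ‖a β • Literature.MathematicalPhysics.QuantumLattice.siteToE y‖ ≤ ℓ := mem_closedBall_zero_iff.mp (hvb hm)
      have hy3 : (y 0 : ℝ) + 3 ≤ (L : ℝ) := le_of_mul_le_mul_left (by nlinarith [hL.2]) haβ
      have hy1 : (0 : ℤ) < y 0 := by exact_mod_cast hy0
      exact ⟨by omega, by exact_mod_cast hy3⟩
    let SV : Finset (Literature.MathematicalPhysics.QuantumLattice.ZdEdge 4) := ((Literature.Probability.LatticeModels.box 4 L).filter fun y => 1 ≤ y 0 ∧ y 0 + 3 ≤ (L : ℤ)).biUnion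
      fun y => r.curvature.supp.image fun e => (e.1 - -y, e.2)
    have hSV : ∀ e ∈ SV, 0 ≤ e.1 0 ∧ e.1 0 + 1 ≤ (L : ℤ) := by
      intro e he
      obtain ⟨y, hy, he'⟩ := Finset.mem_biUnion.1 he
      have hw := (Finset.mem_filter.1 hy).2
      have hn := Cruxes.OSLegsFromFemtoAndGap.DlrCollarTransfer.near_of_mem_supp_dens r he' 0
      constructor <;> omega
    have hVS : Literature.MathematicalPhysics.QuantumLattice.IsCylinder (Vs v β L) SV := by
      intro U W hUW
      refine Finset.sum_congr rfl fun y hy => ?_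
      by_cases hvy : v (a β • Literature.MathematicalPhysics.QuantumLattice.siteToE y) = 0
      · simp only [hvy, zero_mul]
      · congr 1
        exact Cruxes.OSLegsFromFemtoAndGap.DlrCollarTransfer.isCylinder_dens r y (fun e he => hUW e (Finset.mem_coe.2 (Finset.mem_biUnion.2
          ⟨y, Finset.mem_filter.2 ⟨hy, hwin y hvy⟩, Finset.mem_coe.1 he⟩)))
    -- reflection positivity on the odd torus: Gram inequality and positivity of the mirror form
    have hpX := Cruxes.NT.MarkovMirror.dependsOn_posHalf_of_window (G := G) L hXS hSX
    have hpV := Cruxes.NT.MarkovMirror.dependsOn_posHalf_of_window (G := G) L hVS hSV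
    have hXm := (hXc.comp (Literature.MathematicalPhysics.QuantumLattice.continuous_torusLift (d := 4) (G := G) (2 * L + 1))).measurable
    have hVm := (hVc.comp (Literature.MathematicalPhysics.QuantumLattice.continuous_torusLift (d := 4) (G := G) (2 * L + 1))).measurable
    have hbd : ∀ F : Literature.MathematicalPhysics.QuantumLattice.LGConfig 4 G → ℝ, Continuous F →
        ∃ K : ℝ, ∀ U : Literature.MathematicalPhysics.QuantumFieldTheory.GaugeConfig 4 (2 * L + 1) G, |F (Literature.MathematicalPhysics.QuantumLattice.torusLift (2 * L + 1) U)| ≤ K := by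
      intro F hFc
      obtain ⟨K, hK⟩ := isCompact_univ.exists_bound_of_continuousOn
        ((hFc.comp (Literature.MathematicalPhysics.QuantumLattice.continuous_torusLift (d := 4) (G := G) (2 * L + 1))).continuousOn)
      exact ⟨K, fun U => by simpa only [Function.comp, Real.norm_eq_abs] using hK U (Set.mem_univ U)⟩
    have gram := Cruxes.NT.Reflection.sq_cov_negReflect_le_odd_pos (d := 4) r.ρ (S := L) rfl hL1
      r.continuous hβ.2.2 hXm hVm (hbd _ hXc) (hbd _ hVc) hpX hpV
    have pos := Cruxes.NT.ConjugateResponse.cov_negReflect_self_nonneg r.ρ hL1 r.continuous hβ.2.2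
      hVm (hbd _ hVc) hpV
    simp only [Function.comp_def, Literature.MathematicalPhysics.QuantumFieldTheory.torusLift_negReflect] at gram pos
    change (E β L (fun U => Xf (θ U) * Vs v β L U) - E β L Xf * E β L (Vs v β L)) ^ 2 ≤
      (E β L (fun U => Xf (θ U) * Xf U) - E β L Xf ^ 2) * MF v β L at gram
    change 0 ≤ MF v β L at pos
    have hsq : ε₁ ^ 2 ≤ (E β L (fun U => Xf (θ U) * Vs v β L U) - E β L Xf * E β L (Vs v β L)) ^ 2 := by
      calc ε₁ ^ 2 ≤ |E β L (fun U => Xf (θ U) * Vs v β L U) - E β L Xf * E β L (Vs v β L)| ^ 2 :=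
            pow_le_pow_left₀ hε₁.le hF' 2
        _ = _ := sq_abs _
    have hmax : 0 < max C₂ 1 := lt_of_lt_of_le one_pos (le_max_right _ _)
    have hprod := mul_le_mul_of_nonneg_right (hC'.trans (le_max_left C₂ 1)) pos
    rw [div_le_iff₀ hmax]
    linarith
  -- STEP B: clause (i) of LowerBounds from the bare floor (pin at radius 1) and the shared defect item.
  have hi : ∃ (v : SchwartzMap (EuclideanSpace ℝ (Fin 4)) ℝ) (ε β₅ Λ₅ : ℝ),
      tsupport (v : EuclideanSpace ℝ (Fin 4) → ℝ) ⊆ {y : EuclideanSpace ℝ (Fin 4) | 0 < y 0} ∧ 0 < ε ∧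
      ∀ β : ℝ, β₅ ≤ β → ∀ L : ℕ, Λ₅ ≤ a β * L →
        ε ≤ Cruxes.OSLegsFromFemtoAndGap.DlrCollarTransfer.Q2 G r β L (a β) (Literature.MathematicalPhysics.QuantumLattice.thetaTest 4 v) v := by
    obtain ⟨v₀, ε₀, β₀, Λ₀, hv₀, -, hε₀, hM₀⟩ := bare 1 one_pos
    obtain ⟨ℓ₃, hℓ₃, hdef⟩ := h₄ G hG r a ha ha0 ⟨v₀, ε₀, β₀, Λ₀, hv₀, hε₀, hM₀⟩
    obtain ⟨v, ε, β₁, Λ₁, hv, hvb, hε, hM⟩ := bare ℓ₃ hℓ₃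
    obtain ⟨β₇, Λ₇, hD⟩ := hdef v hv hvb (ε / 2) (by positivity)
    refine ⟨v, ε / 2, max β₁ β₇, max Λ₁ Λ₇, hv, by positivity, ?_⟩
    intro β hβ L hL
    have h1 := hM β ((le_max_left _ _).trans hβ) L ((le_max_left _ _).trans hL)
    have h2 : |Cruxes.OSLegsFromFemtoAndGap.DlrCollarTransfer.Q2 G r β L (a β) (Literature.MathematicalPhysics.QuantumLattice.thetaTest 4 v) v - MF v β L| ≤ ε / 2 :=
      hD β ((le_max_right _ _).trans hβ) L ((le_max_right _ _).trans hL)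
    rw [abs_le] at h2
    linarith [h2.1, h2.2]
  -- STEP C: the declared residual supplies clause (ii).
  obtain ⟨a', ha', ha'0, hLB⟩ := h₃ G hG r a ha ha0 hi
  exact ⟨r, a', ha', ha'0, hLB⟩

end Summit.QuantumFields.YangMills.Theses.GradientFlowWitness
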